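import Mathlib
import Literature.Analysis.FluidPDE.CurlFreeLiouville
import Literature.Analysis.FluidPDE.TaoAveragedNondegeneracy
import HarnessLib

/-!
# Crux `PoloidalLiouville` (stmt-NavierStokesRegularity-1222, wall W1), crux idea «steady-centre-sieve» (ns-idea-15 g5,
# `Cruxes/PoloidalLiouville/CentreJetSketch.lean`): first S-lemmas in the kernel — `IrrotationalSteadyLiouville` (R3) and
# `ZonalSatisfiesStrainLaw` (sanity), bodies VERBATIM

Support file (Theorems-side; seat ns-wall-eng-7 g4, cell ns-wall-extremal, W1 adjunct; `--supports
stmt-NavierStokesRegularity-1222 --as helper`).  The crux workfile `CentreJetSketch.lean` (namespace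
`…Cruxes.PoloidalLiouville.CentreJet`) cannot be imported from `Theorems/`; the statements below are the BODIES of its Props
verbatim (with the sketch's `IsSteadyNSOn univ V p` unfolded), in the Theorems-side namespace `…Theorems.PoloidalLiouville.CentreJet`,
so that a by-name glue against a Theorems-side Defs twin is a one-liner later:

* `CentreJet.irrotationalSteadyLiouville` — body of (R3, S) `IrrotationalSteadyLiouville`: a bounded classical steady Navier–Stokes flow
  on `ℝ³` with identically vanishing vorticity is constant.  Proof: `curl V = 0`, `div V = 0`, `V ∈ C²` bounded ⇒ constant, by the tree's
  `Literature.Analysis.FluidPDE.eq_of_curl_eq_zero_of_isDivFree_of_bounded` (`CurlFreeLiouville.lean`: each coordinate is a bounded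
  harmonic function; Liouville — KNSS 2009 Lemma 3.1); the steady equation itself is not needed.
* `CentreJet.zonalSatisfiesStrainLaw` — body of (sanity, S) `ZonalSatisfiesStrainLaw`: the zonal endomorphism `λ·𝟙 + μ·c ⊗ c` satisfies
  the degree-2 centre law `⟪y, c × M y⟫ = 0` (coordinates).

HONEST LABEL: elementary lemmas about typed objects of one crux idea (the steady stratum's negation record); the card's conjectures
`SteadyLocalRigidity(N)`, `NoTypeNCentre`, `NoTriaxialStagnationCentre`, its target `SteadyUnthreadedLiouville`, the crux
`PoloidalLiouville` (1222) and NS regularity remain OPEN and untouched; information-grade for W1 (movement 0).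
[cite: KochNadirashviliSereginSverak2009, Lemma 3.1 (arXiv p. 7)] [cite: MajdaBertozziCUP2002, §1.1 (vector identities)]
-/

-- the summit and its single problem share the name (D-0017 nested layout)
set_option linter.dupNamespace false

noncomputable section

open Set Function
open scoped RealInnerProductSpace
open Literature.Analysis.FluidPDE

namespace Summit.NavierStokesRegularity.NavierStokesRegularity.Theorems.PoloidalLiouville.CentreJet

/-- ★ **(R3) `IrrotationalSteadyLiouville`, body verbatim** (the sketch's `IsSteadyNSOn univ V p` unfolded): if the vorticity of a
bounded classical steady flow on `ℝ³` vanishes identically, the flow is constant.  (`curl V = 0`, `div V = 0`, bounded, `C²` ⇒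
each coordinate is a bounded harmonic function ⇒ constant; the momentum equation is not used.) -/
theorem irrotationalSteadyLiouville :
    ∀ (V : EuclideanSpace ℝ (Fin 3) → EuclideanSpace ℝ (Fin 3)) (p : EuclideanSpace ℝ (Fin 3) → ℝ),
      (ContDiffOn ℝ 3 V univ ∧ ContDiffOn ℝ 1 p univ ∧
          (∀ x ∈ (univ : Set (EuclideanSpace ℝ (Fin 3))), VectorCalculus.divergence V x = 0) ∧
          ∀ x ∈ (univ : Set (EuclideanSpace ℝ (Fin 3))),
            fderiv ℝ V x (V x) + gradient p x = Laplacian.laplacian V x) →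
      (∃ B : ℝ, ∀ x, ‖V x‖ ≤ B) → (∀ x, curl V x = 0) →
      ∃ b : EuclideanSpace ℝ (Fin 3), ∀ x, V x = b := by
  rintro V p ⟨hV, -, hdiv, -⟩ ⟨B, hB⟩ hcurl
  have hV2 : ContDiff ℝ 2 V := (contDiffOn_univ.1 hV).of_le (by norm_num)
  have hdf : VectorCalculus.IsDivFree V := fun x => hdiv x (mem_univ x)
  exact ⟨V 0, fun x => eq_of_curl_eq_zero_of_isDivFree_of_bounded hV2 hcurl hdf hB x 0⟩

/-- **(sanity) `ZonalSatisfiesStrainLaw`, body verbatim**: the zonal endomorphism `y ↦ λ y + μ⟪c, y⟫ c` satisfies `⟪y, c × M y⟫ = 0`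
(converse direction of the degree-2 centre law `CentreStrainLawAlgebra`). -/
theorem zonalSatisfiesStrainLaw :
    ∀ (c y : EuclideanSpace ℝ (Fin 3)) (l μ : ℝ), inner ℝ y (cross c (l • y + (μ * inner ℝ c y) • c)) = 0 := by
  intro c y l μ
  simp only [Tao2016.real_inner_fin3, Tao2016.cross_apply_zero, Tao2016.cross_apply_one, Tao2016.cross_apply_two,
    PiLp.add_apply, PiLp.smul_apply, smul_eq_mul]
  ring

end Summit.NavierStokesRegularity.NavierStokesRegularity.Theorems.PoloidalLiouville.CentreJet

end
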